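import Literature.MathematicalPhysics.KineticTheory.LangevinChainDynkin
import Literature.Probability.Process.HarrisTheorem
import Mathlib.Analysis.SpecialFunctions.Log.Basic
import HarnessLib

/-!
# The pinned chain: Harris' theorem on the skeleton chain, and CEHR Theorem 2.13 up to H2, minorisation and Hörmander

Trunk T-KINETIC (Literature/MathematicalPhysics/KineticTheory). Provefact unit for the named fact
`CuneoEckmannHairerReyBellet2018_thm213` (`LangevinSemigroup.lean`): Cuneo–Eckmann–Hairer–
Rey-Bellet 2018, Theorem 2.13 for the pinned anharmonic chain — (1) at most one invariant
probability measure, each with a smooth density; (2) an invariant probability measure `μ⋆`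
integrating `e^{ϑH}`; (3) the exponential convergence (2.5). After `LangevinChainDynkin.lean`
(the transition semigroup `pinnedChainSemigroup` of the SDE (2.2), constructed, with the Feller
property, Dynkin's identity and (3.4)), `LangevinChainHormander.lean` (Prop. 4.1 proved; smooth
densities from Hörmander's Thm 1.1) and `LangevinChainLyapunov.lean` (Krylov–Bogoliubov), the
printed proof of Theorem 2.13 (= Thm 3.1: Props. 3.3, 3.6, 3.7, 3.8) needs three more inputs:
the Lyapunov condition H2 (CEHR Thm 5.1, named fact `CuneoEckmannHairerReyBellet2018_H2`), the
minorisation of Prop. 3.6 ("every compact set is small, for all large times"), and Harris'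
ergodic theorem in the form of Hairer–Mattingly 2011
(`Literature/Probability/Process/HarrisTheorem.lean`, PROVED). This file proves everything else:

* `LangevinChainSemigroup.kernel_nat_mul` — the skeleton chain `P_{n t₀} = (P_{t₀})ⁿ` of a
  Langevin-chain semigroup (Mathlib's kernel powers).
* `pinnedChainSemigroup_exists_isInvariant` — PROVED from H2: Theorem 2.13 (2) for THE
  constructed semigroup (Krylov–Bogoliubov, as in `LangevinChainLyapunov.lean`, but for the
  witness `pinnedChainSemigroup` rather than an existentially packaged semigroup).
* `pinnedChainSemigroup_harris` — PROVED from H2 and the minorisation hypothesis: Assumptions 1–2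
  of Hairer–Mattingly for the skeleton `P = P_m` (`m ∈ ℕ` large) with `V = e^{ϑH}`: drift
  `P_m V ≤ κᵐ V + c/(1-κ)` by iterating H2 at `t* = 1` (CEHR (3.5)), minorisation on the compact
  sublevel set `{V ≤ R}`, `R = (2c/(1-κ) + 1)/(1-κ)`, for `m ≥ t_C`; hence (Harris) uniqueness of
  the invariant probability measure of `P_m`, finite `V`-moments and geometric convergence.
* `pinnedChainSemigroup_exp_convergence` — PROVED: the exponential convergence (2.5),
  `sup_{|f| ≤ e^{ϑH}, f ∈ C} |P_t f(z) - μ⋆(f)| ≤ C e^{ϑH(z)} e^{-ct}`, for every invariant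
  probability measure `μ⋆` of the semigroup (CEHR proof of Prop. 3.8: Harris on the skeleton,
  (3.4) for the intermediate times `t = n t₀ + r`).
* `CuneoEckmannHairerReyBellet2018_thm213_of_H2_of_minorization_of_hormander` — PROVED:
  Theorem 2.13 follows from H2, the minorisation statement of Prop. 3.6 and Hörmander 1967
  Thm 1.1 (the witness is `pinnedChainSemigroup`; uniqueness among ALL invariant probability
  measures from the skeleton uniqueness; smooth densities from
  `CuneoEckmannHairerReyBellet2018_smoothDensity_of_hormander`).

So after this file the discharge of `CuneoEckmannHairerReyBellet2018_thm213` rests on exactly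
three printed results not proved in the tree: CEHR Thm 5.1 / Rem 5.2 (H2, named fact
`CuneoEckmannHairerReyBellet2018_H2`), Hörmander 1967 Thm 1.1 (named fact
`Literature.Analysis.Distribution.Hormander1967_thm11`), and CEHR Prop. 3.6 (minorisation on
compact sets), which enters here as an explicit HYPOTHESIS spelled out verbatim (no new named
fact is introduced by this file, D-0026).

## The minorisation hypothesis (CEHR Prop. 3.6)

Printed (§3.2, "every compact set is small in the terminology of [MT]"): "Proposition 3.6.
Assume Condition H1. Then, for every compact set `C`, there exists a time `t_C` such that for all
`t ≥ t_C`, there exists a non-negative and non-trivial measure `ν` (which may depend on `t`) such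
that `P_t(z, ·) ≥ ν` for all `z ∈ C`." Here `P_t(z, ·)` are the transition probabilities (2.3)
of (2.2) — in the tree the constructed kernels `OscillatorChain.transitionKernel` (the law of the
strong solution) — and H1 (Hörmander's bracket condition) holds for the pinned chain by Prop. 4.1
(`OscillatorChain.isBracketGenerating_hormanderFamily`). Its printed proof uses Prop. 3.2 (smooth,
jointly continuous transition densities `p_t(z,z')`: Hörmander's theorem for `∂_t - L`) and the
irreducibility statement of Prop. 3.3 (Gibbs measure of the equal-temperature system, ergodic
decomposition), neither of which is in the tree. The hypothesis `h36` of the theorems below is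
this statement for the transition kernels of the pinned chain: for every compact `C` there is
`t_C` such that for every `t ≥ t_C` some nonzero measure `ν` satisfies `ν ≤ P_t(z, ·)` for all
`z ∈ C` ("non-trivial" = nonzero; finiteness follows from `ν ≤ P_t(z,·)` when `C ≠ ∅`).

## References

* N. Cuneo, J.-P. Eckmann, M. Hairer, L. Rey-Bellet, *Non-equilibrium steady states for networks
  of oscillators*, Electron. J. Probab. 23 (2018) no. 55 (arXiv:1712.09413): Thm 2.13, §3
  (3.4)–(3.6), Props. 3.6, 3.7, 3.8 (proof), Thm 5.1 / Rem 5.2. Page numbers in docstrings refer to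
  the arXiv version.
* M. Hairer, J. C. Mattingly, *Yet another look at Harris' ergodic theorem for Markov chains*,
  Progr. Probab. 63 (2011) 109–117 (arXiv:0810.2777), Thms 1.2, 1.3, 3.1.

## Design choices

* The existence of the invariant measure is taken from Krylov–Bogoliubov (the tree's
  `Literature.Probability.Process.MarkovSemigroup.exists_invariant_of_lyapunov`), not from
  Hairer–Mattingly Thm 3.2; uniqueness and convergence from
  `Literature.Probability.Process.Harris.harris`.
* The Lyapunov function `e^{ϑH}` is handled as the `ℝ≥0`-valued `(e^{ϑH}).toNNReal` inside the
  proofs (the abstract theorems take `V : X → ℝ≥0`); statements are in terms of `e^{ϑH}` and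
  `ENNReal.ofReal (e^{ϑH})` (definitionally the same).
-/

noncomputable section

open MeasureTheory ProbabilityTheory Filter Topology Set
open scoped NNReal ENNReal BoundedContinuousFunction

namespace Literature.MathematicalPhysics.KineticTheory.HeatConduction

open Literature.Probability.Process OscillatorChain

variable {N : ℕ}

/-! ### The skeleton chain of a Markov semigroup -/

namespace LangevinChainSemigroup

variable {P : OscillatorChain} {T_L T_R : ℝ} (S : LangevinChainSemigroup P N T_L T_R)

/-- **The skeleton chain**: `P_{n t₀} = (P_{t₀})ⁿ` (Chapman–Kolmogorov; Mathlib's monoid powers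
of kernels). [folklore] -/
theorem kernel_nat_mul (t₀ : ℝ≥0) (n : ℕ) : S.kernel (n * t₀) = S.kernel t₀ ^ n := by
  induction n with
  | zero => rw [Nat.cast_zero, zero_mul, S.kernel_zero, pow_zero, Harris.one_eq_id]
  | succ n ih =>
    rw [Nat.cast_succ, add_mul, one_mul, S.kernel_add, ih, ← Harris.pow_succ_eq_comp']

/-- An invariant measure of the semigroup is invariant for every skeleton kernel. [folklore] -/
theorem IsInvariant.invariant {μ : Measure (PhaseSpace N)} (h : S.IsInvariant μ) (t : ℝ≥0) :
    Kernel.Invariant (S.kernel t) μ :=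
  h t

end LangevinChainSemigroup

/-- Euclidean division of a time by a positive step: `t = r + n t₀` with `r < t₀`. [folklore] -/
theorem exists_eq_add_nat_mul_of_pos {t₀ : ℝ≥0} (ht₀ : 0 < t₀) (t : ℝ≥0) :
    ∃ (n : ℕ) (r : ℝ≥0), r < t₀ ∧ t = r + n * t₀ := by
  have h2 : (⌊t / t₀⌋₊ : ℝ≥0) * t₀ ≤ t := by
    calc (⌊t / t₀⌋₊ : ℝ≥0) * t₀ ≤ t / t₀ * t₀ :=
          mul_le_mul_of_nonneg_right (Nat.floor_le (by positivity)) (by positivity)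
      _ = t := div_mul_cancel₀ t ht₀.ne'
  refine ⟨⌊t / t₀⌋₊, t - ⌊t / t₀⌋₊ * t₀, ?_, ?_⟩
  · have h1 : t < (⌊t / t₀⌋₊ + 1 : ℝ≥0) * t₀ := by
      have := Nat.lt_floor_add_one (t / t₀)
      calc t = t / t₀ * t₀ := (div_mul_cancel₀ t ht₀.ne').symm
        _ < _ := mul_lt_mul_of_pos_right (by exact_mod_cast this) ht₀
    rw [tsub_lt_iff_left h2]
    calc t < (⌊t / t₀⌋₊ + 1 : ℝ≥0) * t₀ := h1
      _ = ⌊t / t₀⌋₊ * t₀ + t₀ := by ring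
  · rw [tsub_add_cancel_of_le h2]

section Pinned

variable {ω₂ lam β γ : ℝ} (hω : 0 < ω₂) (hl : 0 ≤ lam) (hβ : 0 < β) (hγ : 0 < γ)
  (hN : 0 < N) {T_L T_R : ℝ} (hL : 0 < T_L) (hR : 0 < T_R)
include hω hl hβ hγ hN hL hR

/-! ### Theorem 2.13 (2) for the constructed semigroup (Krylov–Bogoliubov) -/

/-- **CEHR Theorem 2.13 (2) for the transition semigroup of the pinned chain, from H2**
(Prop. 3.7, Krylov–Bogoliubov): `pinnedChainSemigroup` has an invariant probability measure under
which `e^{ϑH}` is integrable for every `0 < ϑ < 1/max(T_L, T_R)` (one measure for all `ϑ`: the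
Krylov–Bogoliubov theorem of `KrylovBogoliubov.lean` is applied to the whole family of Lyapunov
functions, whose orbit integrals are bounded by H2 at `t* = 1`, (3.4) on `[0,1)` and (3.5)–(3.6)).
[cite: CuneoEckmannHairerReyBellet2018, Thm 2.13 (2) and Prop 3.7] -/
theorem pinnedChainSemigroup_exists_isInvariant (h2 : CuneoEckmannHairerReyBellet2018_H2) :
    ∃ μ : Measure (PhaseSpace N), IsProbabilityMeasure μ ∧
      (pinnedChainSemigroup hω hl hβ.le hγ.le hN hL.le hR.le).IsInvariant μ ∧
      ∀ ϑ : ℝ, 0 < ϑ → ϑ < 1 / max T_L T_R →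
        Integrable (fun z => Real.exp (ϑ * (pinnedChain ω₂ lam β γ).hamiltonian N z)) μ := by
  set S := pinnedChainSemigroup hω hl hβ.le hγ.le hN hL.le hR.le with hS
  have hF : ∀ (t : ℝ≥0) (g : PhaseSpace N →ᵇ ℝ), Continuous (S.act t g) :=
    continuous_act_pinnedChainSemigroup hω hl hβ.le hγ.le hN hL.le hR.le
  have hTm : 0 < 1 / max T_L T_R := by positivity
  -- the family of Lyapunov functions `e^{ϑH}`, `0 < ϑ < 1/T_max`
  let ι := {ϑ : ℝ // 0 < ϑ ∧ ϑ < 1 / max T_L T_R}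
  let V : ι → PhaseSpace N → ℝ≥0 := fun ϑ x =>
    (Real.exp (ϑ.1 * (pinnedChain ω₂ lam β γ).hamiltonian N x)).toNNReal
  have hVapply : ∀ (ϑ : ι) (x : PhaseSpace N),
      (V ϑ x : ℝ≥0∞) = ENNReal.ofReal (Real.exp (ϑ.1 * (pinnedChain ω₂ lam β γ).hamiltonian N x)) :=
    fun ϑ x => rfl
  have hV : ∀ ϑ : ι, Continuous (V ϑ) := fun ϑ =>
    continuous_real_toNNReal.comp (Real.continuous_exp.comp
      (continuous_const.mul (pinnedChain_continuous_hamiltonian ω₂ lam β γ N)))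
  -- H2 at `t* = 1` and (3.4) on `[0,1)`, in the form consumed by the abstract theorem
  have hlyap : ∀ ϑ : ι, ∃ (tstar : ℝ≥0) (a b c : ℝ≥0∞), 0 < tstar ∧ a < 1 ∧ b ≠ ⊤ ∧ c ≠ ⊤ ∧
      (∀ x, ∫⁻ y, V ϑ y ∂(S.kernel tstar x) ≤ a * V ϑ x + b) ∧
      (∀ r : ℝ≥0, r < tstar → ∀ x, ∫⁻ y, V ϑ y ∂(S.kernel r x) ≤ c * V ϑ x) := by
    intro ϑ
    obtain ⟨a, c, K, ha0, ha1, hc, -, hbound⟩ :=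
      h2 ω₂ lam β γ hω hl hβ hγ N T_L T_R hN hL hR ϑ.1 ϑ.2.1 ϑ.2.2 1 one_pos
    refine ⟨1, ENNReal.ofReal a, ENNReal.ofReal c,
      ENNReal.ofReal (Real.exp (ϑ.1 * γ * (T_L + T_R))), one_pos,
      ENNReal.ofReal_lt_one.2 ha1, ENNReal.ofReal_ne_top, ENNReal.ofReal_ne_top,
      fun x => ?_, fun r hr x => ?_⟩
    · refine (hbound x).trans ?_
      rw [hVapply, ← ENNReal.ofReal_mul ha0.le,
        ← ENNReal.ofReal_add (by positivity) (by positivity)]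
      refine ENNReal.ofReal_le_ofReal (add_le_add le_rfl ?_)
      calc c * K.indicator 1 x ≤ c * 1 := by
            refine mul_le_mul_of_nonneg_left ?_ hc.le
            exact Set.indicator_le_self' (fun _ _ => zero_le_one) x
        _ = c := mul_one c
    · refine (lintegral_exp_mul_hamiltonian_pinnedChainSemigroup_le hω hl hβ.le hγ.le hN hL.le
        hR.le hL hR ϑ.2.1 ϑ.2.2 r x).trans ?_
      rw [hVapply, ← ENNReal.ofReal_mul (by positivity)]
      refine ENNReal.ofReal_le_ofReal (mul_le_mul_of_nonneg_right ?_ (by positivity))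
      refine Real.exp_le_exp.2 ?_
      have hr' : ((r : ℝ≥0) : ℝ) ≤ 1 := by exact_mod_cast hr.le
      have h0 : 0 ≤ ϑ.1 * γ * (T_L + T_R) := by
        have := ϑ.2.1; positivity
      nlinarith
  -- a distinguished index with compact sublevel sets
  let ϑ₀ : ι := ⟨1 / max T_L T_R / 2, by positivity, half_lt_self hTm⟩
  have hcpt : ∀ R : ℝ≥0, IsCompact {x | V ϑ₀ x ≤ R} := fun R =>
    pinnedChain_isCompact_setOf_exp_le hω hl hβ.le γ N (θ := ϑ₀.1) (by positivity) R
  obtain ⟨μ, hμ, hinv, hfin⟩ := MarkovSemigroup.exists_invariant_of_lyapunov S.kernel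
    S.kernel_zero S.kernel_add S.measurable_kernel hF V hV hlyap ϑ₀ hcpt 0
  refine ⟨μ, hμ, hinv, fun ϑ h0 h1 => ?_⟩
  refine ⟨(Real.continuous_exp.comp (continuous_const.mul
    (pinnedChain_continuous_hamiltonian ω₂ lam β γ N))).aestronglyMeasurable, ?_⟩
  have hlt := hfin ⟨ϑ, h0, h1⟩
  simp only [hVapply] at hlt
  show ∫⁻ x, ‖Real.exp (ϑ * (pinnedChain ω₂ lam β γ).hamiltonian N x)‖ₑ ∂μ < ⊤
  simpa only [Real.enorm_eq_ofReal (Real.exp_nonneg _)] using hlt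

/-! ### Harris' theorem for the skeleton chain `P_m`, `m ∈ ℕ` large -/

/-- **Assumptions 1–2 of Hairer–Mattingly for the skeleton chain, and their consequences**
(CEHR proof of Prop. 3.8: "We will apply the main result of [Hairer–Mattingly 2011] to the
discrete-time semigroup `(P^{nt₀})` … `C = {z : V(z) ≤ R}` … we choose `t₀ ≥ t_C` with the `t_C`
from Prop. 3.6"). For `0 < ϑ < 1/max(T_L,T_R)` and `V = e^{ϑH}`: H2 at `t* = 1` gives
`P_1 V ≤ κV + c`, hence `P_m V ≤ κᵐ V + c/(1-κ)` (CEHR (3.5)); with `R = (2c/(1-κ) + 1)/(1-κ)`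
the sublevel set `{V ≤ R}` is compact, the minorisation hypothesis (Prop. 3.6) provides `t_C`, and for the integer
`m = max(1, ⌈t_C⌉)` the kernel `P_m` satisfies the drift condition with `γ = κᵐ ≤ κ` and the
minorisation `P_m(z, ·) ≥ ν`, normalised to `α ν'` with `ν'` a probability measure. Harris' theorem
(`Literature.Probability.Process.Harris.harris`) then yields `ᾱ ∈ (0,1)`, `b > 0` with: `P_m` has
at most one invariant probability measure; every invariant probability measure `μ` of `P_m` has
`∫ e^{ϑH} dμ < ∞` and `|P_mⁿ φ(x) - μ(φ)| ≤ ᾱⁿ (2 + b e^{ϑH(x)} + b μ(e^{ϑH}))` for all measurable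
`φ` with `|φ| ≤ 1 + b e^{ϑH}`.
[cite: CuneoEckmannHairerReyBellet2018, Prop 3.8 (proof)] -/
theorem pinnedChainSemigroup_harris (h2 : CuneoEckmannHairerReyBellet2018_H2)
    (h36 : ∀ C : Set (PhaseSpace N), IsCompact C → ∃ t_C : ℝ≥0, ∀ t : ℝ≥0, t_C ≤ t →
      ∃ ν : Measure (PhaseSpace N), ν ≠ 0 ∧
        ∀ z ∈ C, ν ≤ (pinnedChain ω₂ lam β γ).transitionKernel N T_L T_R t z)
    {ϑ : ℝ} (hϑ0 : 0 < ϑ) (hϑ1 : ϑ < 1 / max T_L T_R) :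
    ∃ (m : ℕ) (abar b : ℝ), 0 < m ∧ 0 < abar ∧ abar < 1 ∧ 0 < b ∧
      (∀ μ₁ μ₂ : Measure (PhaseSpace N), IsProbabilityMeasure μ₁ → IsProbabilityMeasure μ₂ →
        Kernel.Invariant ((pinnedChainSemigroup hω hl hβ.le hγ.le hN hL.le hR.le).kernel m) μ₁ →
        Kernel.Invariant ((pinnedChainSemigroup hω hl hβ.le hγ.le hN hL.le hR.le).kernel m) μ₂ →
        μ₁ = μ₂) ∧
      (∀ μ : Measure (PhaseSpace N), IsProbabilityMeasure μ →
        Kernel.Invariant ((pinnedChainSemigroup hω hl hβ.le hγ.le hN hL.le hR.le).kernel m) μ →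
        ∫⁻ z, ENNReal.ofReal (Real.exp (ϑ * (pinnedChain ω₂ lam β γ).hamiltonian N z)) ∂μ ≠ ∞ ∧
        ∀ (n : ℕ) (φ : PhaseSpace N → ℝ), Measurable φ →
          (∀ x, |φ x| ≤ 1 + b * Real.exp (ϑ * (pinnedChain ω₂ lam β γ).hamiltonian N x)) →
          ∀ x, |∫ z, φ z ∂(((pinnedChainSemigroup hω hl hβ.le hγ.le hN hL.le hR.le).kernel m ^ n) x)
              - ∫ z, φ z ∂μ| ≤
            abar ^ n * (2 + b * Real.exp (ϑ * (pinnedChain ω₂ lam β γ).hamiltonian N x) +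
              b * (∫⁻ z, ENNReal.ofReal
                (Real.exp (ϑ * (pinnedChain ω₂ lam β γ).hamiltonian N z)) ∂μ).toReal)) := by
  set S := pinnedChainSemigroup hω hl hβ.le hγ.le hN hL.le hR.le with hS
  set Hm := (pinnedChain ω₂ lam β γ).hamiltonian N with hHm
  -- the Lyapunov function `V = e^{ϑH}` as an `ℝ≥0`-valued function
  set V : PhaseSpace N → ℝ≥0 := fun z => (Real.exp (ϑ * Hm z)).toNNReal with hVdef
  have hVc : Continuous V := continuous_real_toNNReal.comp (Real.continuous_exp.comp
    (continuous_const.mul (pinnedChain_continuous_hamiltonian ω₂ lam β γ N)))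
  have hV : Measurable V := hVc.measurable
  have hVcoe : ∀ z, (V z : ℝ≥0∞) = ENNReal.ofReal (Real.exp (ϑ * Hm z)) := fun z => rfl
  have hVreal : ∀ z, (V z : ℝ) = Real.exp (ϑ * Hm z) := fun z =>
    Real.coe_toNNReal _ (Real.exp_pos _).le
  -- H2 at `t* = 1`: the drift condition for `P₁`
  obtain ⟨κ₀, c, K, hκ₀, hκ₁, hc, -, hbound⟩ :=
    h2 ω₂ lam β γ hω hl hβ hγ N T_L T_R hN hL hR ϑ hϑ0 hϑ1 1 one_pos
  set a : ℝ≥0 := κ₀.toNNReal with ha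
  set b₀ : ℝ≥0 := c.toNNReal with hb₀
  have ha1 : a < 1 := by
    rw [← NNReal.coe_lt_coe, ha, Real.coe_toNNReal _ hκ₀.le, NNReal.coe_one]; exact hκ₁
  have hdrift1 : ∀ z, ∫⁻ y, V y ∂(S.kernel 1 z) ≤ (a : ℝ≥0∞) * V z + b₀ := by
    intro z
    refine (hbound z).trans ?_
    calc ENNReal.ofReal (κ₀ * Real.exp (ϑ * Hm z) + c * K.indicator 1 z)
        ≤ ENNReal.ofReal (κ₀ * Real.exp (ϑ * Hm z)) + ENNReal.ofReal (c * K.indicator 1 z) :=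
          ENNReal.ofReal_add_le
      _ ≤ ENNReal.ofReal (κ₀ * Real.exp (ϑ * Hm z)) + ENNReal.ofReal c := by
          refine add_le_add le_rfl (ENNReal.ofReal_le_ofReal ?_)
          calc c * K.indicator 1 z ≤ c * 1 := by
                refine mul_le_mul_of_nonneg_left ?_ hc.le
                exact Set.indicator_le_self' (fun _ _ => zero_le_one) z
            _ = c := mul_one c
      _ = ENNReal.ofReal κ₀ * ENNReal.ofReal (Real.exp (ϑ * Hm z)) + ENNReal.ofReal c := by
          rw [ENNReal.ofReal_mul hκ₀.le]
      _ = (a : ℝ≥0∞) * V z + b₀ := rfl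
  -- the skeleton at an integer time `m ≥ 1`: drift with `γ = aᵐ`, `K = b₀/(1-a)`
  set B : ℝ≥0 := b₀ / (1 - a) with hB
  have h1a : 0 < 1 - a := tsub_pos_of_lt ha1
  set R : ℝ≥0 := (2 * B + 1) / (1 - a) with hRdef
  have hRa : (1 - a) * R = 2 * B + 1 := by
    rw [hRdef, mul_comm, div_mul_cancel₀ _ h1a.ne']
  -- the compact sublevel set `{V ≤ R}` and Prop. 3.6
  have hcpt : IsCompact {z : PhaseSpace N | V z ≤ R} :=
    pinnedChain_isCompact_setOf_exp_le hω hl hβ.le γ N hϑ0 R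
  obtain ⟨t_C, ht_C⟩ := h36 _ hcpt
  set m : ℕ := max 1 ⌈t_C⌉₊ with hm
  have hm1 : 1 ≤ m := le_max_left _ _
  have hm0 : m ≠ 0 := by omega
  have hmt : t_C ≤ (m : ℝ≥0) := (Nat.le_ceil t_C).trans (by exact_mod_cast le_max_right _ _)
  obtain ⟨ν, hν0, hνle⟩ := ht_C (m : ℝ≥0) hmt
  -- the kernel `P = P_m = P₁ᵐ`
  set P : Kernel (PhaseSpace N) (PhaseSpace N) := S.kernel m with hPdef
  have hPpow : P = S.kernel 1 ^ m := by
    rw [hPdef, ← S.kernel_nat_mul 1 m, mul_one]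
  haveI : IsMarkovKernel P := S.isMarkovKernel _
  have hdriftP : ∀ z, ∫⁻ y, V y ∂(P z) ≤ ((a ^ m : ℝ≥0) : ℝ≥0∞) * V z + B := by
    intro z
    rw [hPpow, ENNReal.coe_pow]
    exact Harris.lintegral_pow_le_of_drift (S.kernel 1) hV ha1 hdrift1 m z
  have hγ1 : a ^ m < 1 := pow_lt_one₀ zero_le ha1 hm0
  have hRcond : 2 * B < (1 - a ^ m) * R := by
    have ham : a ^ m ≤ a := pow_le_of_le_one zero_le ha1.le hm0
    calc 2 * B < 2 * B + 1 := lt_add_one _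
      _ = (1 - a) * R := hRa.symm
      _ ≤ (1 - a ^ m) * R := mul_le_mul_of_nonneg_right (tsub_le_tsub_left ham 1) zero_le
  -- the minorisation, normalised: `P(z, ·) ≥ α ν'` on `{V ≤ R}` with `ν'` a probability measure
  have hminor : ∃ (α : ℝ≥0) (ν' : Measure (PhaseSpace N)), 0 < α ∧ IsProbabilityMeasure ν' ∧
      ∀ x, V x ≤ R → α • ν' ≤ P x := by
    by_cases hC : ({z : PhaseSpace N | V z ≤ R}).Nonempty
    · obtain ⟨z₀, hz₀⟩ := hC
      have hνz₀ : ν ≤ P z₀ := hνle z₀ hz₀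
      have hνfin : ν univ ≠ ∞ :=
        ne_top_of_le_ne_top (measure_ne_top (P z₀) univ) (Measure.le_iff'.1 hνz₀ univ)
      haveI : IsFiniteMeasure ν := ⟨lt_top_iff_ne_top.2 hνfin⟩
      haveI : NeZero ν := ⟨hν0⟩
      have hνuniv : ν univ ≠ 0 := Measure.measure_univ_ne_zero.2 hν0
      refine ⟨(ν univ).toNNReal, (ν univ)⁻¹ • ν, ENNReal.toNNReal_pos hνuniv hνfin,
        inferInstance, fun x hx => ?_⟩
      have hsmul : (ν univ).toNNReal • ((ν univ)⁻¹ • ν) = ν := by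
        rw [ENNReal.smul_def, ENNReal.coe_toNNReal hνfin, smul_smul,
          ENNReal.mul_inv_cancel hνuniv hνfin, one_smul]
      rw [hsmul]
      exact hνle x hx
    · refine ⟨1, Measure.dirac 0, one_pos, inferInstance, fun x hx => ?_⟩
      exact absurd ⟨x, hx⟩ hC
  obtain ⟨α, ν', hα, hν', hmin⟩ := hminor
  haveI := hν'
  -- Harris' theorem for `P`
  obtain ⟨abar, b, h0, h1, hb, -, huniq, hmom⟩ :=
    Harris.harris P hV hγ1 hdriftP hα hRcond hmin
  refine ⟨m, abar, b, Nat.pos_of_ne_zero hm0, h0, h1, hb, huniq, fun μ hμ hinv => ?_⟩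
  obtain ⟨hle, hgeo⟩ := hmom μ hμ hinv
  refine ⟨?_, fun n φ hφm hφ x => ?_⟩
  · have : ∫⁻ z, (V z : ℝ≥0∞) ∂μ ≠ ∞ := ne_top_of_le_ne_top ENNReal.coe_ne_top hle
    simpa only [hVcoe] using this
  · have hφ' : ∀ x, |φ x| ≤ 1 + b * V x := fun x => by rw [hVreal]; exact hφ x
    have h := hgeo n φ hφm hφ' x
    simpa only [hVreal, hVcoe] using h

/-! ### The exponential convergence (2.5) -/

/-- **CEHR Theorem 2.13 (3), the exponential convergence (2.5), for the transition semigroup of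
the pinned chain, from H2 and Prop. 3.6** (printed proof of Prop. 3.8): for
`0 < ϑ < 1/max(T_L, T_R)` and an invariant probability measure `μ⋆` of `pinnedChainSemigroup`
there are `C, c > 0` with `|P_t f(z) - ∫ f dμ⋆| ≤ C e^{ϑH(z)} e^{-ct}` for all `z`, `t ≥ 0` and
all continuous `f` with `|f| ≤ e^{ϑH}`. Proof: Harris on the skeleton `P_{t₀}`, `t₀ = m`
(`pinnedChainSemigroup_harris`) gives `|P_{nt₀} f(y) - μ⋆(f)| ≤ C₁ ᾱⁿ e^{ϑH(y)}`; for
`t = n t₀ + r`, `r < t₀`, the Markov property and (3.4) give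
`|P_t f(z) - μ⋆(f)| ≤ C₁ ᾱⁿ P_r e^{ϑH}(z) ≤ C₁ e^{C_* t₀} ᾱⁿ e^{ϑH(z)}`, and `ᾱⁿ ≤ ᾱ⁻¹ e^{-ct}`
with `c = -log ᾱ / t₀`. [cite: CuneoEckmannHairerReyBellet2018, Thm 2.13 (3) and Prop 3.8] -/
theorem pinnedChainSemigroup_exp_convergence (h2 : CuneoEckmannHairerReyBellet2018_H2)
    (h36 : ∀ C : Set (PhaseSpace N), IsCompact C → ∃ t_C : ℝ≥0, ∀ t : ℝ≥0, t_C ≤ t →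
      ∃ ν : Measure (PhaseSpace N), ν ≠ 0 ∧
        ∀ z ∈ C, ν ≤ (pinnedChain ω₂ lam β γ).transitionKernel N T_L T_R t z)
    {ϑ : ℝ} (hϑ0 : 0 < ϑ) (hϑ1 : ϑ < 1 / max T_L T_R)
    (μ : Measure (PhaseSpace N)) [IsProbabilityMeasure μ]
    (hinv : (pinnedChainSemigroup hω hl hβ.le hγ.le hN hL.le hR.le).IsInvariant μ) :
    ∃ C c : ℝ, 0 < C ∧ 0 < c ∧
      ∀ (z : PhaseSpace N) (t : ℝ≥0) (f : PhaseSpace N → ℝ), Continuous f →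
        (∀ y, |f y| ≤ Real.exp (ϑ * (pinnedChain ω₂ lam β γ).hamiltonian N y)) →
        |(pinnedChainSemigroup hω hl hβ.le hγ.le hN hL.le hR.le).act t f z - ∫ y, f y ∂μ| ≤
          C * Real.exp (ϑ * (pinnedChain ω₂ lam β γ).hamiltonian N z) * Real.exp (-c * t) := by
  set S := pinnedChainSemigroup hω hl hβ.le hγ.le hN hL.le hR.le with hS
  set Hm := (pinnedChain ω₂ lam β γ).hamiltonian N with hHm
  obtain ⟨m, abar, b, hm, ha0, ha1, hb, -, hmom⟩ :=
    pinnedChainSemigroup_harris hω hl hβ hγ hN hL hR h2 h36 hϑ0 hϑ1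
  obtain ⟨hμV, hgeo⟩ := hmom μ ‹_› (hinv m)
  -- notation
  set V : PhaseSpace N → ℝ≥0 := fun z => (Real.exp (ϑ * Hm z)).toNNReal with hVdef
  have hVc : Continuous V := continuous_real_toNNReal.comp (Real.continuous_exp.comp
    (continuous_const.mul (pinnedChain_continuous_hamiltonian ω₂ lam β γ N)))
  have hV : Measurable V := hVc.measurable
  have hVcoe : ∀ z, (V z : ℝ≥0∞) = ENNReal.ofReal (Real.exp (ϑ * Hm z)) := fun z => rfl
  have hVreal : ∀ z, (V z : ℝ) = Real.exp (ϑ * Hm z) := fun z =>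
    Real.coe_toNNReal _ (Real.exp_pos _).le
  have hV1 : ∀ z, 1 ≤ Real.exp (ϑ * Hm z) := fun z =>
    Real.one_le_exp (mul_nonneg hϑ0.le (pinnedChain_hamiltonian_nonneg hω.le hl hβ.le γ N z))
  set t₀ : ℝ≥0 := (m : ℝ≥0) with ht₀def
  have ht₀ : 0 < t₀ := by rw [ht₀def]; exact_mod_cast hm
  set P : Kernel (PhaseSpace N) (PhaseSpace N) := S.kernel t₀ with hPdef
  have ht₀r : (0 : ℝ) < t₀ := by exact_mod_cast ht₀
  set mV : ℝ := (∫⁻ z, ENNReal.ofReal (Real.exp (ϑ * Hm z)) ∂μ).toReal with hmV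
  have hmV0 : 0 ≤ mV := ENNReal.toReal_nonneg
  have hb0 : b ≠ 0 := hb.ne'
  set C₁ : ℝ := b⁻¹ * (2 + b * mV) + 1 with hC₁def
  have hC₁ : 0 < C₁ := by rw [hC₁def]; positivity
  set Cstar : ℝ := ϑ * γ * (T_L + T_R) with hCstardef
  have hCstar : 0 ≤ Cstar := by rw [hCstardef]; positivity
  set c : ℝ := -Real.log abar / t₀ with hcdef
  have hlog : Real.log abar < 0 := Real.log_neg ha0 ha1
  have hc : 0 < c := by rw [hcdef]; exact div_pos (by linarith) ht₀r
  refine ⟨C₁ * Real.exp (Cstar * t₀) / abar, c, by positivity, hc, fun z t f hf hfV => ?_⟩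
  -- finiteness of the `V`-moments along the semigroup, (3.4)
  have h34 : ∀ (s : ℝ≥0) (x : PhaseSpace N), ∫⁻ y, (V y : ℝ≥0∞) ∂(S.kernel s x) ≤
      ENNReal.ofReal (Real.exp (Cstar * s) * Real.exp (ϑ * Hm x)) := fun s x =>
    lintegral_exp_mul_hamiltonian_pinnedChainSemigroup_le hω hl hβ.le hγ.le hN hL.le hR.le hL hR
      hϑ0 hϑ1 s x
  have h34' : ∀ (s : ℝ≥0) (x : PhaseSpace N), ∫⁻ y, (V y : ℝ≥0∞) ∂(S.kernel s x) ≠ ∞ :=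
    fun s x => ne_top_of_le_ne_top ENNReal.ofReal_ne_top (h34 s x)
  have hfm : Measurable f := hf.measurable
  have hfV' : ∀ y, |f y| ≤ 0 + 1 * V y := fun y => by rw [hVreal, zero_add, one_mul]; exact hfV y
  have hfint : ∀ (s : ℝ≥0) (x : PhaseSpace N), Integrable f (S.kernel s x) := fun s x =>
    Harris.integrable_of_abs_le_affine hV (h34' s x) hfm hfV'
  -- Harris on the skeleton: `|Pⁿ f(x) - μ(f)| ≤ ᾱⁿ C₁ e^{ϑH(x)}`
  have hskel : ∀ (n : ℕ) (x : PhaseSpace N),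
      |∫ y, f y ∂((P ^ n) x) - ∫ y, f y ∂μ| ≤ abar ^ n * C₁ * Real.exp (ϑ * Hm x) := by
    intro n x
    have hφm : Measurable fun y => b * f y := hfm.const_mul b
    have hφ : ∀ y, |b * f y| ≤ 1 + b * Real.exp (ϑ * Hm y) := fun y => by
      rw [abs_mul, abs_of_pos hb]
      have := mul_le_mul_of_nonneg_left (hfV y) hb.le
      linarith
    have h := hgeo n (fun y => b * f y) hφm hφ x
    rw [integral_const_mul, integral_const_mul, ← mul_sub, abs_mul, abs_of_pos hb] at h
    have h' : |∫ y, f y ∂((P ^ n) x) - ∫ y, f y ∂μ| ≤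
        abar ^ n * (b⁻¹ * (2 + b * mV) + Real.exp (ϑ * Hm x)) := by
      have h1 := mul_le_mul_of_nonneg_left h (inv_nonneg.2 hb.le)
      rw [inv_mul_cancel_left₀ hb0] at h1
      refine h1.trans (le_of_eq ?_)
      field_simp
      ring
    refine h'.trans ?_
    rw [mul_assoc]
    refine mul_le_mul_of_nonneg_left ?_ (pow_nonneg ha0.le n)
    have hE := hV1 x
    have hpos : 0 ≤ b⁻¹ * (2 + b * mV) := by positivity
    rw [hC₁def]
    nlinarith [mul_nonneg hpos (sub_nonneg.2 hE)]
  -- `t = r + n t₀`, `r < t₀`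
  obtain ⟨n, r, hr, rfl⟩ := exists_eq_add_nat_mul_of_pos ht₀ t
  -- the Markov property: `P_t f(z) = ∫ Pⁿ f(y) P_r(z, dy)`
  set g : PhaseSpace N → ℝ := fun y => ∫ w, f w ∂((P ^ n) y) with hg
  have hgm : Measurable g := (hfm.stronglyMeasurable.integral_kernel (κ := P ^ n)).measurable
  have hact : S.act (r + n * t₀) f z = ∫ y, g y ∂(S.kernel r z) := by
    have hint : Integrable f (((P ^ n) ∘ₖ S.kernel r) z) := by
      have := hfint (r + n * t₀) z
      rwa [S.kernel_add, S.kernel_nat_mul] at this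
    rw [LangevinChainSemigroup.act_apply, S.kernel_add, S.kernel_nat_mul, ← hPdef]
    rw [Kernel.comp_apply] at hint ⊢
    exact Harris.integral_comp_measure (P ^ n) (S.kernel r z) hint
  rw [hact]
  -- integrate the skeleton bound against `P_r(z, ·)`
  have hgb : ∀ y, |g y - ∫ w, f w ∂μ| ≤ abar ^ n * C₁ * Real.exp (ϑ * Hm y) := fun y => hskel n y
  have hgi : Integrable g (S.kernel r z) := by
    refine Harris.integrable_of_abs_le_affine hV (h34' r z) hgm (A := |∫ w, f w ∂μ|)
      (B := abar ^ n * C₁) fun y => ?_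
    have h1 := hgb y
    rw [hVreal]
    have h2 : |g y| ≤ |∫ w, f w ∂μ| + |g y - ∫ w, f w ∂μ| := by
      have := abs_add_le (∫ w, f w ∂μ) (g y - ∫ w, f w ∂μ); rwa [add_sub_cancel] at this
    linarith
  have hVi : Integrable (fun y => (V y : ℝ)) (S.kernel r z) :=
    Harris.integrable_coe_of_lintegral_ne_top hV (h34' r z)
  have hsub : (∫ y, g y ∂(S.kernel r z)) - ∫ w, f w ∂μ =
      ∫ y, (g y - ∫ w, f w ∂μ) ∂(S.kernel r z) := by
    rw [integral_sub hgi (integrable_const _), integral_const, probReal_univ, one_smul]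
  have hPr : (∫⁻ y, (V y : ℝ≥0∞) ∂(S.kernel r z)).toReal ≤
      Real.exp (Cstar * t₀) * Real.exp (ϑ * Hm z) := by
    refine (ENNReal.toReal_le_of_le_ofReal (by positivity) (h34 r z)).trans ?_
    refine mul_le_mul_of_nonneg_right (Real.exp_le_exp.2 ?_) (Real.exp_pos _).le
    exact mul_le_mul_of_nonneg_left (by exact_mod_cast hr.le) hCstar
  -- `ᾱⁿ ≤ ᾱ⁻¹ e^{-ct}`
  have hpow : abar ^ n ≤ abar⁻¹ * Real.exp (-c * ((r + n * t₀ : ℝ≥0) : ℝ)) := by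
    have hlogeq : Real.log abar = -c * t₀ := by
      rw [hcdef, neg_mul, div_mul_cancel₀ _ ht₀r.ne', neg_neg]
    have hn : abar ^ n = Real.exp (n * Real.log abar) := by
      rw [Real.exp_nat_mul, Real.exp_log ha0]
    have hinv' : abar⁻¹ = Real.exp (c * t₀) := by
      have : Real.exp (c * t₀) = Real.exp (-Real.log abar) := by
        rw [hlogeq]; simp only [neg_mul, neg_neg]
      rw [this, Real.exp_neg, Real.exp_log ha0]
    rw [hn, hinv', ← Real.exp_add]
    refine Real.exp_le_exp.2 ?_
    rw [hlogeq]
    push_cast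
    have hr' : ((r : ℝ≥0) : ℝ) ≤ t₀ := by exact_mod_cast hr.le
    have hc0 : 0 ≤ c := hc.le
    nlinarith [mul_nonneg hc0 (sub_nonneg.2 hr')]
  calc |(∫ y, g y ∂(S.kernel r z)) - ∫ w, f w ∂μ|
      = |∫ y, (g y - ∫ w, f w ∂μ) ∂(S.kernel r z)| := by rw [hsub]
    _ ≤ ∫ y, |g y - ∫ w, f w ∂μ| ∂(S.kernel r z) := abs_integral_le_integral_abs
    _ ≤ ∫ y, abar ^ n * C₁ * (V y : ℝ) ∂(S.kernel r z) := by
        refine integral_mono (hgi.sub (integrable_const _)).abs (hVi.const_mul _) fun y => ?_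
        have := hgb y
        rwa [← hVreal] at this
    _ = abar ^ n * C₁ * (∫⁻ y, (V y : ℝ≥0∞) ∂(S.kernel r z)).toReal := by
        rw [integral_const_mul, Harris.integral_coe_eq_toReal hV]
    _ ≤ abar ^ n * C₁ * (Real.exp (Cstar * t₀) * Real.exp (ϑ * Hm z)) :=
        mul_le_mul_of_nonneg_left hPr (by positivity)
    _ ≤ (abar⁻¹ * Real.exp (-c * ((r + n * t₀ : ℝ≥0) : ℝ))) * C₁ *
          (Real.exp (Cstar * t₀) * Real.exp (ϑ * Hm z)) := by
        gcongr
    _ = C₁ * Real.exp (Cstar * t₀) / abar * Real.exp (ϑ * Hm z) *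
          Real.exp (-c * ((r + n * t₀ : ℝ≥0) : ℝ)) := by
        ring

end Pinned

/-! ### Assembly: Theorem 2.13 from H2, the minorisation of Prop. 3.6 and Hörmander's theorem -/

/-- **Cuneo–Eckmann–Hairer–Rey-Bellet 2018, Theorem 2.13 for the pinned chain, from the named
facts H2 (CEHR Thm 5.1 / Rem 5.2) and Hörmander 1967 Thm 1.1 and the minorisation statement of
CEHR Prop. 3.6 (hypothesis `h36`, quoted in the module docstring, for the transition kernels of
the pinned chain in the parameter range of the fact).** The witness is the constructed transition
semigroup `pinnedChainSemigroup` of the SDE (2.2):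
(1) uniqueness of the invariant probability measure (any two are invariant for the skeleton
`P_m` of `pinnedChainSemigroup_harris`, hence equal by Harris' theorem) and smooth densities
(`CuneoEckmannHairerReyBellet2018_smoothDensity_of_hormander`, Prop. 3.2/4.1 with Hörmander's
theorem); (2) existence of an invariant probability measure integrating every `e^{ϑH}`,
`0 < ϑ < 1/max(T_L,T_R)` (`pinnedChainSemigroup_exists_isInvariant`, Krylov–Bogoliubov);
(3) the exponential convergence (2.5) (`pinnedChainSemigroup_exp_convergence`).
[cite: CuneoEckmannHairerReyBellet2018, Thm 2.13 and Prop 3.6] -/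
theorem CuneoEckmannHairerReyBellet2018_thm213_of_H2_of_minorization_of_hormander
    (h2 : CuneoEckmannHairerReyBellet2018_H2)
    (h36 : ∀ ω₂ lam β γ : ℝ, 0 < ω₂ → 0 ≤ lam → 0 < β → 0 < γ →
      ∀ (N : ℕ) (T_L T_R : ℝ), 0 < N → 0 < T_L → 0 < T_R →
        ∀ C : Set (PhaseSpace N), IsCompact C →
          ∃ t_C : ℝ≥0, ∀ t : ℝ≥0, t_C ≤ t →
            ∃ ν : Measure (PhaseSpace N), ν ≠ 0 ∧
              ∀ z ∈ C, ν ≤ (pinnedChain ω₂ lam β γ).transitionKernel N T_L T_R t z)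
    (hH : Literature.Analysis.Distribution.Hormander1967_thm11) :
    CuneoEckmannHairerReyBellet2018_thm213 := by
  intro ω₂ lam β γ hω hl hβ hγ N T_L T_R hN hL hR
  have hTm : 0 < 1 / max T_L T_R := by positivity
  have h36' := h36 ω₂ lam β γ hω hl hβ hγ N T_L T_R hN hL hR
  obtain ⟨m, abar, b, -, -, -, -, huniq, -⟩ := pinnedChainSemigroup_harris hω hl hβ hγ hN hL hR
    h2 h36' (ϑ := 1 / max T_L T_R / 2) (by positivity) (half_lt_self hTm)
  obtain ⟨μs, hμs, hinv, hint⟩ := pinnedChainSemigroup_exists_isInvariant hω hl hβ hγ hN hL hR h2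
  refine ⟨pinnedChainSemigroup hω hl hβ.le hγ.le hN hL.le hR.le, ?_, ?_, μs, hμs, hinv,
    fun ϑ hϑ0 hϑ1 => ⟨hint ϑ hϑ0 hϑ1, ?_⟩⟩
  · intro μ ν hμ hν hμi hνi
    exact huniq μ ν hμ hν (hμi _) (hνi _)
  · intro μ hμ hμi
    haveI := hμ
    exact (CuneoEckmannHairerReyBellet2018_smoothDensity_of_hormander hH).hasSmoothDensity_of_isInvariant
      hω hl hβ hγ hN hL hR _ μ hμi
  · exact pinnedChainSemigroup_exp_convergence hω hl hβ hγ hN hL hR h2 h36' hϑ0 hϑ1 μs hinv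


end Literature.MathematicalPhysics.KineticTheory.HeatConduction
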